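import Mathlib

/-!
# Crux `ClassTransfer` (stmt-ValiantsHypothesis-7287), negative side — tools:
# block-antidiagonal permutation sums and the signed fixed-point sum `Σ_γ sgn γ 4^{c₁ γ}`

Lead prover of line `registered` (= `Cruxes/ClassTransfer/Lines/birth.lean`).  Two pure-Mathlib
lemmas used by `Negative/FalsifierPerHard.lean` (the permanent is a projection of the two-cycle
weight family `T_n = Σ_σ sgn(σ) 2^{N₂(σ)} x^σ`, hence `T ∈ VP ⇒ VP = VNP`):

* `sum_perm_blockAntidiag` — for an entry pattern `E row col` on `ι ⊕ ι` vanishing on the two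
  diagonal blocks, `Σ_σ W(σ) ∏_y E(σ y, y)` only sees the block maps
  `σ = (inl i ↦ inr (α i), inr j ↦ inl (β j))`, and the product splits into the two blocks
  (the bookkeeping of `Matrix.det_fromBlocks_zero₂₁` with an arbitrary weight `W` in place of
  the sign);
* `sum_sign_mul_four_pow_fixed_ne_zero` — `Σ_{γ ∈ S_m} sgn(γ) 4^{c₁(γ)} = det(3·1 + J_m)
  = 3^m (1 + m/3) ≠ 0` (matrix determinant lemma);
* `sum_sign_mul_indicator_derangement_ne_zero` — the signed derangement count
  `Σ_γ sgn(γ) [c₁(γ) = 0] = det(J_m - 1) = (-1)^m (1 - m) ≠ 0` for `m ≠ 1` (the constant met by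
  the 2-cycle-free determinant `D₂ = T(0)`).

No definitions. [folklore]
-/

set_option linter.dupNamespace false

noncomputable section

namespace Summit.ValiantsHypothesis.ValiantsHypothesis.Theorems.ClassTransfer.Negative

open Equiv Finset

/-! ## Sums over permutations of `α ⊕ α` against a block-antidiagonal pattern -/

/-- **Block-antidiagonal permutation sums.**  If the entry pattern `E row col` vanishes on the
two diagonal blocks, then in `Σ_σ W(σ) ∏_y E(σ y, y)` only the block maps
`σ = (inl i ↦ inr (α i), inr j ↦ inl (β j))` survive, and the product splits.  (The bookkeeping
of `Matrix.det_fromBlocks_zero₂₁`, for an arbitrary weight `W` in place of the sign.)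
[folklore] -/
theorem sum_perm_blockAntidiag {ι : Type*} [Fintype ι] [DecidableEq ι] {S : Type*} [CommRing S]
    (W : Perm (ι ⊕ ι) → S) (E : (ι ⊕ ι) → (ι ⊕ ι) → S)
    (hLL : ∀ i j, E (Sum.inl i) (Sum.inl j) = 0) (hRR : ∀ i j, E (Sum.inr i) (Sum.inr j) = 0) :
    ∑ σ : Perm (ι ⊕ ι), W σ * ∏ y, E (σ y) y =
      ∑ p : Perm ι × Perm ι,
        W ((Equiv.sumCongr p.1 p.2).trans (Equiv.sumComm ι ι)) *
          ((∏ i, E (Sum.inr (p.1 i)) (Sum.inl i)) * ∏ j, E (Sum.inl (p.2 j)) (Sum.inr j)) := by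
  classical
  set Φ : Perm ι × Perm ι → Perm (ι ⊕ ι) :=
    fun p => (Equiv.sumCongr p.1 p.2).trans (Equiv.sumComm ι ι) with hΦ
  have hΦl : ∀ (p : Perm ι × Perm ι) (i : ι), Φ p (Sum.inl i) = Sum.inr (p.1 i) := by
    intro p i; simp [hΦ]
  have hΦr : ∀ (p : Perm ι × Perm ι) (j : ι), Φ p (Sum.inr j) = Sum.inl (p.2 j) := by
    intro p j; simp [hΦ]
  have hΦinj : Function.Injective Φ := by
    intro p q h
    have h' : ∀ y, Φ p y = Φ q y := fun y => by rw [h]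
    refine Prod.ext (Equiv.ext fun i => ?_) (Equiv.ext fun j => ?_)
    · have := h' (Sum.inl i)
      rw [hΦl, hΦl] at this
      exact Sum.inr_injective this
    · have := h' (Sum.inr j)
      rw [hΦr, hΦr] at this
      exact Sum.inl_injective this
  -- the right-hand side is the sum over the image of `Φ`
  have hrhs : ∑ p : Perm ι × Perm ι, W (Φ p) *
      ((∏ i, E (Sum.inr (p.1 i)) (Sum.inl i)) * ∏ j, E (Sum.inl (p.2 j)) (Sum.inr j)) =
      ∑ σ ∈ (univ : Finset (Perm ι × Perm ι)).map ⟨Φ, hΦinj⟩, W σ * ∏ y, E (σ y) y := by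
    rw [Finset.sum_map]
    refine Finset.sum_congr rfl fun p _ => ?_
    simp only [Function.Embedding.coeFn_mk]
    rw [Fintype.prod_sum_type]
    simp only [hΦl, hΦr]
  rw [hrhs]
  symm
  refine Finset.sum_subset (Finset.subset_univ _) fun σ _ hσ => ?_
  -- a permutation outside the image hits a diagonal block somewhere
  by_cases hR : ∀ i, ∃ a, σ (Sum.inl i) = Sum.inr a
  · by_cases hL : ∀ j, ∃ b, σ (Sum.inr j) = Sum.inl b
    · exfalso
      have hmaps : Set.MapsTo (σ.trans (Equiv.sumComm ι ι)) (Set.range Sum.inl)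
          (Set.range Sum.inl) := by
        rintro _ ⟨i, rfl⟩
        obtain ⟨a, ha⟩ := hR i
        exact ⟨a, by simp [ha]⟩
      obtain ⟨⟨α, β⟩, hαβ⟩ := Perm.mem_sumCongrHom_range_of_perm_mapsTo_inl hmaps
      apply hσ
      rw [Finset.mem_map]
      refine ⟨(α, β), Finset.mem_univ _, ?_⟩
      simp only [Function.Embedding.coeFn_mk]
      rw [Perm.sumCongrHom_apply] at hαβ
      apply Equiv.ext
      intro y
      have hy := Equiv.congr_fun hαβ y
      simp only [Equiv.trans_apply] at hy
      rw [hΦ]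
      simp only [Equiv.trans_apply]
      rw [hy]
      simp
    · push Not at hL
      obtain ⟨j, hj⟩ := hL
      rcases hx : σ (Sum.inr j) with b | c
      · exact absurd hx (hj b)
      · rw [Finset.prod_eq_zero (Finset.mem_univ (Sum.inr j)) (by rw [hx, hRR]), mul_zero]
  · push Not at hR
    obtain ⟨i, hi⟩ := hR
    rcases hx : σ (Sum.inl i) with b | c
    · rw [Finset.prod_eq_zero (Finset.mem_univ (Sum.inl i)) (by rw [hx, hLL]), mul_zero]
    · exact absurd hx (hi c)


/-! ## The signed fixed-point sum `Σ_γ sgn(γ) 4^{c₁(γ)} = det(3·1 + J) ≠ 0` -/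

/-- `Σ_{γ ∈ S_m} sgn(γ) 4^{c₁(γ)} = det(3·1 + J_m) = 3^m (1 + m/3) ≠ 0`. [folklore] -/
theorem sum_sign_mul_four_pow_fixed_ne_zero (m : ℕ) :
    ∑ γ : Perm (Fin m), ((Perm.sign γ : ℤ) : ℂ) *
      (4 : ℂ) ^ (univ.filter fun i : Fin m => γ i = i).card ≠ 0 := by
  set N : Matrix (Fin m) (Fin m) ℂ := (3 : ℂ) • ((1 : Matrix (Fin m) (Fin m) ℂ) +
    Matrix.vecMulVec (fun _ => (1 / 3 : ℂ)) (fun _ => (1 : ℂ))) with hN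
  have hentry : ∀ i j : Fin m, N i j = if i = j then (4 : ℂ) else 1 := by
    intro i j
    simp only [hN, Matrix.smul_apply, Matrix.add_apply, Matrix.one_apply, Matrix.vecMulVec_apply,
      smul_eq_mul]
    split_ifs <;> norm_num
  have hdet : N.det = ∑ γ : Perm (Fin m), ((Perm.sign γ : ℤ) : ℂ) *
      (4 : ℂ) ^ (univ.filter fun i : Fin m => γ i = i).card := by
    rw [Matrix.det_apply']
    refine Finset.sum_congr rfl fun γ _ => ?_
    congr 1
    simp_rw [hentry]
    rw [Finset.prod_ite, Finset.prod_const, Finset.prod_const_one, mul_one]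
  have hval : N.det = (3 : ℂ) ^ m * (1 + ∑ _i : Fin m, (1 : ℂ) * (1 / 3)) := by
    rw [hN, Matrix.det_smul, Fintype.card_fin, Matrix.vecMulVec_eq Unit,
      Matrix.det_one_add_replicateCol_mul_replicateRow]
    rfl
  rw [← hdet, hval, Finset.sum_const, Finset.card_univ, Fintype.card_fin, nsmul_eq_mul]
  refine mul_ne_zero (pow_ne_zero _ (by norm_num)) ?_
  have h : (1 + (m : ℂ) * (1 * (1 / 3))) = (((1 + (m : ℝ) / 3 : ℝ)) : ℂ) := by
    push_cast; ring
  rw [h, Complex.ofReal_ne_zero]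
  positivity

/-- **Signed derangement count**: `Σ_{γ ∈ S_m} sgn(γ) [c₁(γ) = 0] = det(J_m - 1) = (-1)^m (1 - m)`,
nonzero for `m ≠ 1`. [folklore] -/
theorem sum_sign_mul_indicator_derangement_ne_zero (m : ℕ) (hm : m ≠ 1) :
    ∑ γ : Perm (Fin m), ((Perm.sign γ : ℤ) : ℂ) *
      (if (univ.filter fun i : Fin m => γ i = i).card = 0 then (1 : ℂ) else 0) ≠ 0 := by
  set N : Matrix (Fin m) (Fin m) ℂ := (-1 : ℂ) • ((1 : Matrix (Fin m) (Fin m) ℂ) +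
    Matrix.vecMulVec (fun _ => (-1 : ℂ)) (fun _ => (1 : ℂ))) with hN
  have hentry : ∀ i j : Fin m, N i j = if i = j then (0 : ℂ) else 1 := by
    intro i j
    simp only [hN, Matrix.smul_apply, Matrix.add_apply, Matrix.one_apply, Matrix.vecMulVec_apply,
      smul_eq_mul]
    split_ifs <;> norm_num
  have hdet : N.det = ∑ γ : Perm (Fin m), ((Perm.sign γ : ℤ) : ℂ) *
      (if (univ.filter fun i : Fin m => γ i = i).card = 0 then (1 : ℂ) else 0) := by
    rw [Matrix.det_apply']
    refine Finset.sum_congr rfl fun γ _ => ?_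
    congr 1
    simp_rw [hentry]
    rw [Finset.prod_ite, Finset.prod_const, Finset.prod_const_one, mul_one]
    by_cases h : (univ.filter fun i : Fin m => γ i = i).card = 0
    · rw [h, pow_zero, if_pos rfl]
    · rw [zero_pow h, if_neg h]
  have hval : N.det = (-1 : ℂ) ^ m * (1 + ∑ _i : Fin m, (1 : ℂ) * (-1)) := by
    rw [hN, Matrix.det_smul, Fintype.card_fin, Matrix.vecMulVec_eq Unit,
      Matrix.det_one_add_replicateCol_mul_replicateRow]
    rfl
  rw [← hdet, hval, Finset.sum_const, Finset.card_univ, Fintype.card_fin, nsmul_eq_mul]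
  refine mul_ne_zero (pow_ne_zero _ (by norm_num)) ?_
  have h : (1 + (m : ℂ) * (1 * (-1))) = (((1 - (m : ℝ) : ℝ)) : ℂ) := by
    push_cast; ring
  rw [h, Complex.ofReal_ne_zero, sub_ne_zero]
  exact_mod_cast hm.symm

end Summit.ValiantsHypothesis.ValiantsHypothesis.Theorems.ClassTransfer.Negative
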